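import Summits.NavierStokesRegularity.NavierStokesRegularity.Theorems.EpisodeInduction.Negative.GlobalDesigns
import Summits.NavierStokesRegularity.FluidComputer.PalasekTowerHeredityWitnessUnconditionalRungs

/-!
# KJ-11 kernel: the global-solution lever is CAP-FREE at EVERY starting level — `HeredityFrom k₀`,
# in particular the child crux `HeredityFromTwo`; and a globally solvable design's ladder BREAKS at a
# definite rung

Cell `ns-blowup`, seat `ns-blowup-refuter` (g12), K-row KJ-11; companion of KJ-10
(`Theorems/EpisodeInduction/Negative/GlobalDesigns.lean`, p445785: the lever against the PARENT crux
`EpisodeInductionG = HeredityFrom 1`). NEGATIVE-LANE support lemmas for the route item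
`PalasekTowerBreakdown.HeredityFromTwo` (:= `HeredityFrom 2`, stmt-NavierStokesRegularity-19250) and,
level-uniformly, for every `HeredityFrom k₀` / `HeredityAt k`. LABEL: refuter kernel certificate (E–C
typing over landed files; every input is a DISCHARGED theorem of the tree). WHAT THIS IS NOT: not
Navier–Stokes evidence — no schedule, stage, design or tower is constructed; no `¬ HeredityFromTwo` is
claimed; the existential premise of every lever below (a REGISTERED stage at a level `k₀ ≥ 2`, resp.
`k₀ ≥ 1`, inside a globally regular class) is EMPTY-IN-PRACTICE by the cell's scoping numerics (refuter4
g3 K61 / S-RING-1 j253937; planner g18 STATUS l.4032) — at level `2` even more so than at level `1`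
(floor ratio `Y₂/Y₀ = 256^{0.13·2.1} ≈ 4.5` against measured swirl-free amplification `μ ≤ 1.42`).

THE POINT. The 19250 seat's lever of record (`Theorems/PalasekTowerBreakdownHeredityFromTwoRung.lean`
§3–§4, `palasekTowerBreakdown_not_heredityFromTwo_of_capped_stage / _of_capped_cauchy /
_of_capped_noSwirl`) is priced as «a registered stage at a level `k₀ ≥ 2` PLUS a qualitative all-time
sup CAP `M` on the design's classical solutions», and its docblock records «the printed cap for that
class (Ladyzhenskaya 1968 / Ukhovskii–Yudovich 1968) is NOT in the tree and is NOT used». It IS in the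
tree — DISCHARGED as `axisymmetric_no_swirl_global_regularity_holds` — and NO CAP IS NEEDED AT ALL:
global finite-energy classical SOLVABILITY of the one design suffices, because the chain of registered
stages glued by the child from that stage is a `Realisation` OF THE SAME DESIGN (`Realisation.ofEpisodes_f
/ _u_zero`, this lineage's `ShiftStage.lean`), which `Realisation.not_exists_global_classical` (KJ-10 §1,
`hU` discharged) forbids. So, for every starting level `k₀` (no `1 ≤ k₀` or `2 ≤ k₀` needed):

* §1 (any rates `R`, any `ν > 0`, no heredity hypothesis) `Schedule.exists_realisation_of_nonempty_stages`
  — a design with a registered (`routeG`) stage at EVERY level realises the tower WITH ITS OWN DESIGN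
  (`W.f = S.f`, `W.u 0 = S.u₀`, `W.T = S.T`; the design-remembering form of ecbridge-6's
  `Schedule.nonempty_realisation_of_nonempty_stages`); hence `Schedule.false_of_nonempty_stages_of_global_classical`
  (such a design has NO global finite-energy classical solution), `…_not_axisym_noSwirl_of_nonempty_stages`
  (an UNFORCED one is not axisymmetric swirl-free), `…_false_of_nonempty_stages_of_clayA` (under Clay (A)
  no unforced design reaches every level), and **`Schedule.exists_last_level_of_global_classical`: THE
  LADDER OF A GLOBALLY SOLVABLE DESIGN BREAKS AT A DEFINITE RUNG** — a registered stage at level `k₀`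
  plus a global classical solution of the design give a level `k ≥ k₀` that the design reaches and a
  level `k + 1` that it does NOT reach (`IsEmpty`).
* §2 (wide rates, unit viscosity) `HeredityFrom.nonempty_stage_of_le / _all` (up by heredity, down by
  `Stage.restrictOfAntitone`), **`HeredityFrom.false_of_global_classical`** /
  `not_heredityFrom_of_global_design` — `HeredityFrom k₀` plus ONE registered level-`k₀` stage of a pinned
  rigid quiet schedule whose design is globally classically solvable is absurd; `HeredityFrom.isEmpty_stage_of_noSwirl`
  / `not_heredityFrom_of_noSwirl_design` — `HeredityFrom k₀` EMPTIES the unforced axisymmetric swirl-free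
  class at level `k₀` (two-signed `ω_θ` included; regularity and uniqueness are theorems of the tree);
  `HeredityFrom.isEmpty_unforced_stage_of_clayA`.
* §3 the RUNG-LEVEL reading for the binders 19249/19250: `exists_rungG_not_heredityAt_of_global_classical`
  — a globally solvable registered design reaching level `k₀` yields a level `k ≥ k₀` with `RungG k ∧
  ¬ HeredityAt k` (heredity fails AT A DEFINITE RUNG on that design — WHICH rung is not decided without a
  quantitative cap, which is exactly why `¬ HeredityAtOne` alone still needs K61's typed cap while
  `¬ HeredityFrom k₀` does not); `exists_rungG_not_heredityAt_of_noSwirl` (the same for an unforced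
  swirl-free registered design, fully kernel).
* §4 by the route's decl names (namespace `Summit.NavierStokesRegularity.PalasekTowerBreakdownNegative`):
  `palasekTowerBreakdown_not_heredityFromTwo_of_global_design`, `…_of_noSwirl_design`,
  `palasekTowerBreakdown_heredityFromTwo_isEmpty_stage_of_noSwirl`,
  `palasekTowerBreakdown_not_heredityAtOne_or_not_heredityFromTwo_of_noSwirl_design` (a swirl-free
  registered LEVEL-1 design breaks 19249 or 19250 — and names a definite rung where heredity fails).

Filed as PLAIN negative lemmas (`--supports` 19250), NOT `--negative-modulo`: the premise is
empty-in-practice (K61 (d), planner l.4032 (2)); should a design seat ever register a stage at a level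
`≥ 2` (resp. `≥ 1`) in a globally regular class, `¬ HeredityFromTwo` (resp. `¬ EpisodeInduction`, KJ-10)
is the one-liner of §4 and the planner's banked repair (r4) applies.

References: O. A. Ladyzhenskaya, Zap. Naučn. Sem. LOMI 7 (1968); M. R. Ukhovskii, V. I. Yudovich,
J. Appl. Math. Mech. 32 (1968) — through P. G. Lemarié-Rieusset, *The Navier–Stokes Problem in the 21st
Century*, CRC 2016, Thm 10.4 (p. 285) [cite: LemarieRieusset2016, Thm 10.4 (p. 285)]; T. Tao, Anal. PDE 6
(2013), Cor. 11.4 [cite: Tao2011, Cor. 11.4]; H. Sohr, *The Navier–Stokes Equations*, Birkhäuser 2001,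
Ch. V Thm. 1.5.1 [cite: Sohr2001, Ch. V Thm. 1.5.1]; S. Palasek, arXiv:2605.13827 §4
[cite: Palasek2026ElementaryModel, §4]; C. Fefferman, Clay problem description (2006), (A)
[cite: FeffermanClay2006, (A)].
-/

noncomputable section

namespace Summit.NavierStokesRegularity.FluidComputer.PalasekTowerClayBridge

open Set MeasureTheory Filter Topology Function
open scoped ENNReal ContDiff NNReal
open Literature.Analysis.FluidPDE

/-! ## §1 A design that reaches every level realises the tower with its own design (any `R`, any `ν > 0`) -/

namespace Schedule

variable {ν : ℝ} {R : TowerRates} (S : Schedule R)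

/-- **A design with a registered stage at EVERY level realises the tower — WITH ITS OWN DESIGN**: the
realisation glued by `Realisation.ofEpisodes` from the level-`1` stage and the chain of extensions
(`Stage.exists_extends_of_stage_succ`, no uniqueness hypothesis) has force `S.f`, datum `S.u₀` and
blow-up time `S.T`. [cite: Palasek2026ElementaryModel, §4] -/
theorem exists_realisation_of_nonempty_stages (hν : 0 < ν)
    (h : ∀ k, Nonempty (Stage ν R S (Margins.routeG R) k)) :
    ∃ W : Realisation ν R, W.f = S.f ∧ W.u 0 = S.u₀ ∧ W.T = S.T := by
  obtain ⟨s₁⟩ := h 1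
  have step : ∀ n, ∀ s : Stage ν R S (Margins.routeG R) (n + 1),
      ∃ s' : Stage ν R S (Margins.routeG R) (n + 1 + 1), s.Extends s' := fun n s => by
    obtain ⟨s''⟩ := h (n + 1 + 1)
    exact s.exists_extends_of_stage_succ hν s''
  exact ⟨Realisation.ofEpisodes S s₁ step, Realisation.ofEpisodes_f S s₁ step,
    Realisation.ofEpisodes_u_zero S s₁ step, Realisation.ofEpisodes_T S s₁ step⟩

/-- **A design that reaches every level has NO global finite-energy classical solution** (its
realisation shares datum and force with it; `Realisation.not_exists_global_classical`, `hU` discharged).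
[cite: Tao2011, Cor. 11.4] -/
theorem false_of_nonempty_stages_of_global_classical (hν : 0 < ν)
    (h : ∀ k, Nonempty (Stage ν R S (Margins.routeG R) k))
    {v : ℝ → EuclideanSpace ℝ (Fin 3) → EuclideanSpace ℝ (Fin 3)}
    {q : ℝ → EuclideanSpace ℝ (Fin 3) → ℝ}
    (hcl : IsClassicalNSSolutionOn (Ici 0) ν S.f v q) (h0 : v 0 = S.u₀) (hE : HasBoundedEnergy v) :
    False := by
  obtain ⟨W, hf, hu, -⟩ := S.exists_realisation_of_nonempty_stages hν h
  refine W.not_exists_global_classical hν ⟨v, q, ?_, ?_, hE⟩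
  · rw [hf]
    exact hcl
  · rw [hu, h0]

/-- **An UNFORCED design that reaches every level is not axisymmetric swirl-free** (Ladyzhenskaya /
Ukhovskii–Yudovich, discharged as `axisymmetric_no_swirl_global_regularity_holds`, through
`Realisation.not_axisym_noSwirl_of_force_zero`). [cite: LemarieRieusset2016, Thm 10.4 (p. 285)] -/
theorem not_axisym_noSwirl_of_nonempty_stages (hν : 0 < ν)
    (h : ∀ k, Nonempty (Stage ν R S (Margins.routeG R) k)) (hf : S.f = 0) :
    ¬ (IsAxisymmetric S.u₀ ∧ HasNoSwirl S.u₀) := by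
  obtain ⟨W, hWf, hu, -⟩ := S.exists_realisation_of_nonempty_stages hν h
  rw [← hu]
  exact W.not_axisym_noSwirl_of_force_zero hν (hWf.trans hf)

/-- **Under Clay (A) no UNFORCED design reaches every level** (the summit statement
`NavierStokesRegularity` hands the realisation's datum a global smooth bounded-energy solution, which
`Realisation.not_exists_claySolution` forbids; `hU` discharged). Conditional bookkeeping; neither side
asserted. [cite: FeffermanClay2006, (A)] -/
theorem false_of_nonempty_stages_of_clayA (hA : _root_.NavierStokesRegularity) (hν : 0 < ν)
    (h : ∀ k, Nonempty (Stage ν R S (Margins.routeG R) k)) (hf : S.f = 0) : False := by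
  obtain ⟨W, hWf, -, -⟩ := S.exists_realisation_of_nonempty_stages hν h
  obtain ⟨v, q, hv, hq, hns, hE⟩ :=
    hA ν hν (W.u 0) W.contDiff_datum W.divFree_datum W.datum_decay
  refine W.not_exists_claySolution tao_unconditional_uniqueness_velocity_forced_holds hν
    ⟨v, q, hv, hq, ?_, hE⟩
  rw [hWf, hf]
  exact hns

/-- **THE LADDER OF A GLOBALLY SOLVABLE DESIGN BREAKS AT A DEFINITE RUNG.** A registered stage at
level `k₀` of a design with a global finite-energy classical solution yields a level `k ≥ k₀` that the
design REACHES and whose successor `k + 1` it does NOT reach (else it would reach every level — up by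
the missing break, down by `Stage.restrictOfAntitone` — and realise the tower). Which `k` is not decided
here (that needs a quantitative cap). [cite: Tao2011, Cor. 11.4] -/
theorem exists_last_level_of_global_classical (hν : 0 < ν) {k₀ : ℕ}
    (s : Stage ν R S (Margins.routeG R) k₀)
    {v : ℝ → EuclideanSpace ℝ (Fin 3) → EuclideanSpace ℝ (Fin 3)}
    {q : ℝ → EuclideanSpace ℝ (Fin 3) → ℝ}
    (hcl : IsClassicalNSSolutionOn (Ici 0) ν S.f v q) (h0 : v 0 = S.u₀) (hE : HasBoundedEnergy v) :
    ∃ k, k₀ ≤ k ∧ Nonempty (Stage ν R S (Margins.routeG R) k) ∧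
      IsEmpty (Stage ν R S (Margins.routeG R) (k + 1)) := by
  by_contra hcon
  have hsucc : ∀ k, k₀ ≤ k → Nonempty (Stage ν R S (Margins.routeG R) k) →
      Nonempty (Stage ν R S (Margins.routeG R) (k + 1)) := fun k hk hn => by
    by_contra hne
    exact hcon ⟨k, hk, hn, ⟨fun s' => hne ⟨s'⟩⟩⟩
  have hup : ∀ k, k₀ ≤ k → Nonempty (Stage ν R S (Margins.routeG R) k) := by
    intro k hk
    induction k, hk using Nat.le_induction with
    | base => exact ⟨s⟩
    | succ k hk ih => exact hsucc k hk ih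
  refine S.false_of_nonempty_stages_of_global_classical hν (fun k => ?_) hcl h0 hE
  obtain ⟨s'⟩ := hup (max k k₀) (le_max_right k k₀)
  exact ⟨s'.restrictOfAntitone (Margins.antitone_routeG R) (le_max_left k k₀)⟩

/-- The same for an UNFORCED design with axisymmetric swirl-free datum — fully kernel: its global
classical solution is the tree's theorem `axisymmetric_no_swirl_global_regularity_holds` (the datum is
smooth, divergence-free and rapidly decaying because a stage sits on it).
[cite: LemarieRieusset2016, Thm 10.4 (p. 285)] -/
theorem exists_last_level_of_noSwirl (hν : 0 < ν) {k₀ : ℕ} (s : Stage ν R S (Margins.routeG R) k₀)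
    (hf : S.f = 0) (hA : IsAxisymmetric S.u₀) (hS : HasNoSwirl S.u₀) :
    ∃ k, k₀ ≤ k ∧ Nonempty (Stage ν R S (Margins.routeG R) k) ∧
      IsEmpty (Stage ν R S (Margins.routeG R) (k + 1)) := by
  have hdiv : NSWave0.IsDivFree S.u₀ := by
    rw [← s.initial]
    exact s.classical.divFree 0 ⟨le_rfl, (S.τ_pos k₀).le⟩
  obtain ⟨v, q, hcl, hv0, hbe, -⟩ := axisymmetric_no_swirl_global_regularity_holds ν hν S.u₀
    s.contDiff_datum hdiv S.datum_decay hA hS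
  refine S.exists_last_level_of_global_classical hν s (q := q) ?_ hv0 hbe
  rw [hf]
  exact hcl

end Schedule

/-! ## §2 The lever against `HeredityFrom k₀` — every starting level, no cap (wide rates, `ν = 1`) -/

section Lever

variable {S : Schedule TowerRates.wide}

/-- **Up the ladder** under `HeredityFrom k₀`: a registered level-`k₀` stage of a pinned rigid quiet
schedule gives a registered stage of the same schedule at every level `k ≥ k₀`.
[cite: Palasek2026ElementaryModel, §4] -/
theorem HeredityFrom.nonempty_stage_of_le {k₀ : ℕ} (h : HeredityFrom k₀) (hP : S.Pins 8 (6 / 5))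
    (hR : S.Rigid) (hQ : S.Quiet) (s : Stage 1 TowerRates.wide S (Margins.routeG TowerRates.wide) k₀)
    {k : ℕ} (hk : k₀ ≤ k) :
    Nonempty (Stage 1 TowerRates.wide S (Margins.routeG TowerRates.wide) k) := by
  induction k, hk using Nat.le_induction with
  | base => exact ⟨s⟩
  | succ k hk ih =>
    obtain ⟨s'⟩ := ih
    obtain ⟨s'', -⟩ := h S hP hR hQ k hk s'
    exact ⟨s''⟩

/-- **Up and down**: under `HeredityFrom k₀`, ONE registered level-`k₀` stage of a pinned rigid quiet
schedule gives a registered stage at EVERY level (down by `Stage.restrictOfAntitone`,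
`Margins.antitone_routeG`). [cite: Palasek2026ElementaryModel, §4] -/
theorem HeredityFrom.nonempty_stage_all {k₀ : ℕ} (h : HeredityFrom k₀) (hP : S.Pins 8 (6 / 5))
    (hR : S.Rigid) (hQ : S.Quiet) (s : Stage 1 TowerRates.wide S (Margins.routeG TowerRates.wide) k₀)
    (k : ℕ) :
    Nonempty (Stage 1 TowerRates.wide S (Margins.routeG TowerRates.wide) k) := by
  obtain ⟨s'⟩ := h.nonempty_stage_of_le hP hR hQ s (le_max_right k k₀)
  exact ⟨s'.restrictOfAntitone (Margins.antitone_routeG TowerRates.wide) (le_max_left k k₀)⟩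

/-- **`HeredityFrom k₀` + ONE registered level-`k₀` stage with a globally solvable design is absurd**
— no cap, no symmetry, no `hU`, no restriction on `k₀` (at `k₀ = 1` this is KJ-10's
`EpisodeInductionG.false_of_global_classical`, at `k₀ = 2` the child's). [cite: Palasek2026ElementaryModel, §4] -/
theorem HeredityFrom.false_of_global_classical {k₀ : ℕ} (h : HeredityFrom k₀)
    (hP : S.Pins 8 (6 / 5)) (hR : S.Rigid) (hQ : S.Quiet)
    (s : Stage 1 TowerRates.wide S (Margins.routeG TowerRates.wide) k₀)
    {v : ℝ → EuclideanSpace ℝ (Fin 3) → EuclideanSpace ℝ (Fin 3)}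
    {q : ℝ → EuclideanSpace ℝ (Fin 3) → ℝ}
    (hcl : IsClassicalNSSolutionOn (Ici 0) 1 S.f v q) (h0 : v 0 = S.u₀) (hE : HasBoundedEnergy v) :
    False :=
  S.false_of_nonempty_stages_of_global_classical one_pos (h.nonempty_stage_all hP hR hQ s) hcl h0 hE

/-- **THE GLOBAL-SOLUTION LEVER at starting level `k₀`**, packaged: SOME pinned (`Λ = 8`, `θ = 6/5`)
rigid quiet wide schedule with a registered level-`k₀` stage whose design `(u₀, f)` has a global
finite-energy classical solution refutes `HeredityFrom k₀`. Premise empty-in-practice (K61).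
[cite: Palasek2026ElementaryModel, §4] -/
theorem not_heredityFrom_of_global_design {k₀ : ℕ}
    (h : ∃ (S : Schedule TowerRates.wide)
      (_ : Stage 1 TowerRates.wide S (Margins.routeG TowerRates.wide) k₀)
      (v : ℝ → EuclideanSpace ℝ (Fin 3) → EuclideanSpace ℝ (Fin 3))
      (q : ℝ → EuclideanSpace ℝ (Fin 3) → ℝ),
      S.Pins 8 (6 / 5) ∧ S.Rigid ∧ S.Quiet ∧
      IsClassicalNSSolutionOn (Ici 0) 1 S.f v q ∧ v 0 = S.u₀ ∧ HasBoundedEnergy v) :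
    ¬ HeredityFrom k₀ := by
  rintro hH
  obtain ⟨S, s, v, q, hP, hR, hQ, hcl, h0, hE⟩ := h
  exact hH.false_of_global_classical hP hR hQ s hcl h0 hE

/-- **`HeredityFrom k₀` EMPTIES THE UNFORCED AXISYMMETRIC SWIRL-FREE CLASS AT LEVEL `k₀`** (two-signed
`ω_θ` included; regularity and uniqueness are theorems of the tree). [cite: LemarieRieusset2016, Thm 10.4 (p. 285)] -/
theorem HeredityFrom.isEmpty_stage_of_noSwirl {k₀ : ℕ} (h : HeredityFrom k₀) (hP : S.Pins 8 (6 / 5))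
    (hR : S.Rigid) (hQ : S.Quiet) (hf : S.f = 0) (hA : IsAxisymmetric S.u₀) (hS : HasNoSwirl S.u₀) :
    IsEmpty (Stage 1 TowerRates.wide S (Margins.routeG TowerRates.wide) k₀) :=
  ⟨fun s => S.not_axisym_noSwirl_of_nonempty_stages one_pos (h.nonempty_stage_all hP hR hQ s) hf
    ⟨hA, hS⟩⟩

/-- **The no-swirl lever at starting level `k₀`, packaged**: ONE registered level-`k₀` stage of an
unforced pinned rigid quiet wide schedule with axisymmetric swirl-free datum refutes `HeredityFrom k₀` —
fully kernel, no cap, no sign condition. Premise empty-in-practice (K61 / S-RING-1 / P-RING-0).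
[cite: LemarieRieusset2016, Thm 10.4 (p. 285)] -/
theorem not_heredityFrom_of_noSwirl_design {k₀ : ℕ}
    (h : ∃ (S : Schedule TowerRates.wide)
      (_ : Stage 1 TowerRates.wide S (Margins.routeG TowerRates.wide) k₀),
      S.Pins 8 (6 / 5) ∧ S.Rigid ∧ S.Quiet ∧ S.f = 0 ∧ IsAxisymmetric S.u₀ ∧ HasNoSwirl S.u₀) :
    ¬ HeredityFrom k₀ := by
  rintro hH
  obtain ⟨S, s, hP, hR, hQ, hf, hA, hS⟩ := h
  exact (hH.isEmpty_stage_of_noSwirl hP hR hQ hf hA hS).false s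

/-- **Clay (A) empties the UNFORCED design class under `HeredityFrom k₀` at level `k₀`.** Conditional
bookkeeping; neither side asserted. [cite: FeffermanClay2006, (A)] -/
theorem HeredityFrom.isEmpty_unforced_stage_of_clayA (hA : _root_.NavierStokesRegularity) {k₀ : ℕ}
    (h : HeredityFrom k₀) (hP : S.Pins 8 (6 / 5)) (hR : S.Rigid) (hQ : S.Quiet) (hf : S.f = 0) :
    IsEmpty (Stage 1 TowerRates.wide S (Margins.routeG TowerRates.wide) k₀) :=
  ⟨fun s => S.false_of_nonempty_stages_of_clayA hA one_pos (h.nonempty_stage_all hP hR hQ s) hf⟩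

end Lever

/-! ## §3 The rung-level reading: heredity fails AT A DEFINITE RUNG on a globally solvable design -/

section Rung

variable {S : Schedule TowerRates.wide}

/-- **A globally solvable registered design reaching level `k₀` carries a rung `k ≥ k₀` at which
heredity FAILS**: `RungG k ∧ ¬ HeredityAt k` for some `k ≥ k₀` (the last level the design reaches,
`Schedule.exists_last_level_of_global_classical`). Which `k` is not decided — that is the difference
between `¬ HeredityFrom k₀` (cap-free, §2) and `¬ HeredityAt k₀` (needs a quantitative cap below the
level-`k₀+1` floor, K61). [cite: Tao2011, Cor. 11.4] -/
theorem exists_rungG_not_heredityAt_of_global_classical (hP : S.Pins 8 (6 / 5)) (hR : S.Rigid)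
    (hQ : S.Quiet) {k₀ : ℕ} (s : Stage 1 TowerRates.wide S (Margins.routeG TowerRates.wide) k₀)
    {v : ℝ → EuclideanSpace ℝ (Fin 3) → EuclideanSpace ℝ (Fin 3)}
    {q : ℝ → EuclideanSpace ℝ (Fin 3) → ℝ}
    (hcl : IsClassicalNSSolutionOn (Ici 0) 1 S.f v q) (h0 : v 0 = S.u₀) (hE : HasBoundedEnergy v) :
    ∃ k, k₀ ≤ k ∧ RungG k ∧ ¬ HeredityAt k := by
  obtain ⟨k, hk, ⟨s'⟩, he⟩ := S.exists_last_level_of_global_classical one_pos s hcl h0 hE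
  refine ⟨k, hk, ⟨S, hP, hR, hQ, ⟨s'⟩⟩, fun hH => ?_⟩
  obtain ⟨s'', -⟩ := hH S hP hR hQ s'
  exact he.false s''

/-- The same for an UNFORCED registered design with axisymmetric swirl-free datum — fully kernel.
[cite: LemarieRieusset2016, Thm 10.4 (p. 285)] -/
theorem exists_rungG_not_heredityAt_of_noSwirl (hP : S.Pins 8 (6 / 5)) (hR : S.Rigid) (hQ : S.Quiet)
    {k₀ : ℕ} (s : Stage 1 TowerRates.wide S (Margins.routeG TowerRates.wide) k₀) (hf : S.f = 0)
    (hA : IsAxisymmetric S.u₀) (hS : HasNoSwirl S.u₀) :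
    ∃ k, k₀ ≤ k ∧ RungG k ∧ ¬ HeredityAt k := by
  obtain ⟨k, hk, ⟨s'⟩, he⟩ := S.exists_last_level_of_noSwirl one_pos s hf hA hS
  refine ⟨k, hk, ⟨S, hP, hR, hQ, ⟨s'⟩⟩, fun hH => ?_⟩
  obtain ⟨s'', -⟩ := hH S hP hR hQ s'
  exact he.false s''

end Rung

end Summit.NavierStokesRegularity.FluidComputer.PalasekTowerClayBridge

/-! ## §4 By the route's item names (`Theses/PalasekTowerBreakdown.lean`) -/

namespace Summit.NavierStokesRegularity.PalasekTowerBreakdownNegative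

open Set
open Summit.NavierStokesRegularity.NavierStokesRegularity.Theses
open Summit.NavierStokesRegularity.FluidComputer.PalasekTowerClayBridge
open Literature.Analysis.FluidPDE

/-- **Item 19250 `PalasekTowerBreakdown.HeredityFromTwo` is refuted by any registered design reaching
a level `k₀ ≥ 2` whose forced Cauchy problem has a global finite-energy classical solution** — NO cap
(route decl by name; body `not_heredityFrom_of_global_design` + `HeredityFrom.mono`). Premise
empty-in-practice (K61). [cite: Palasek2026ElementaryModel, §4] -/
theorem palasekTowerBreakdown_not_heredityFromTwo_of_global_design
    (h : ∃ (S : Schedule TowerRates.wide) (k₀ : ℕ)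
      (_ : Stage 1 TowerRates.wide S (Margins.routeG TowerRates.wide) k₀)
      (v : ℝ → EuclideanSpace ℝ (Fin 3) → EuclideanSpace ℝ (Fin 3))
      (q : ℝ → EuclideanSpace ℝ (Fin 3) → ℝ),
      2 ≤ k₀ ∧ S.Pins 8 (6 / 5) ∧ S.Rigid ∧ S.Quiet ∧
      IsClassicalNSSolutionOn (Ici 0) 1 S.f v q ∧ v 0 = S.u₀ ∧ HasBoundedEnergy v) :
    ¬ PalasekTowerBreakdown.HeredityFromTwo := by
  rintro hH
  obtain ⟨S, k₀, s, v, q, hk₀, hP, hR, hQ, hcl, h0, hE⟩ := h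
  exact (HeredityFrom.mono hH hk₀).false_of_global_classical hP hR hQ s hcl h0 hE

/-- **Item 19250 is refuted by any registered UNFORCED axisymmetric swirl-free design reaching a level
`k₀ ≥ 2`** — fully kernel, no cap, no sign condition (Ladyzhenskaya / Ukhovskii–Yudovich and Tao's
forced uniqueness are DISCHARGED theorems of the tree). Premise empty-in-practice (K61 / S-RING-1).
[cite: LemarieRieusset2016, Thm 10.4 (p. 285)] -/
theorem palasekTowerBreakdown_not_heredityFromTwo_of_noSwirl_design
    (h : ∃ (S : Schedule TowerRates.wide) (k₀ : ℕ)
      (_ : Stage 1 TowerRates.wide S (Margins.routeG TowerRates.wide) k₀),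
      2 ≤ k₀ ∧ S.Pins 8 (6 / 5) ∧ S.Rigid ∧ S.Quiet ∧ S.f = 0 ∧
      IsAxisymmetric S.u₀ ∧ HasNoSwirl S.u₀) :
    ¬ PalasekTowerBreakdown.HeredityFromTwo := by
  rintro hH
  obtain ⟨S, k₀, s, hk₀, hP, hR, hQ, hf, hA, hS⟩ := h
  exact ((HeredityFrom.mono hH hk₀).isEmpty_stage_of_noSwirl hP hR hQ hf hA hS).false s

/-- **Under item 19250 the unforced axisymmetric swirl-free class is EMPTY at every level `k ≥ 2`.**
[cite: LemarieRieusset2016, Thm 10.4 (p. 285)] -/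
theorem palasekTowerBreakdown_heredityFromTwo_isEmpty_stage_of_noSwirl
    (hH : PalasekTowerBreakdown.HeredityFromTwo) {S : Schedule TowerRates.wide}
    (hP : S.Pins 8 (6 / 5)) (hR : S.Rigid) (hQ : S.Quiet) (hf : S.f = 0)
    (hA : IsAxisymmetric S.u₀) (hS : HasNoSwirl S.u₀) {k : ℕ} (hk : 2 ≤ k) :
    IsEmpty (Stage 1 TowerRates.wide S (Margins.routeG TowerRates.wide) k) :=
  (HeredityFrom.mono hH hk).isEmpty_stage_of_noSwirl hP hR hQ hf hA hS

/-- **A registered UNFORCED swirl-free LEVEL-1 design breaks one of the two binders — at a definite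
rung**: it yields a level `k ≥ 1` with `RungG k ∧ ¬ HeredityAt k`, hence `¬ HeredityAtOne` (if
`k = 1`) or `¬ HeredityFromTwo` (if `k ≥ 2`). Which one is not decided without a quantitative cap.
[cite: LemarieRieusset2016, Thm 10.4 (p. 285)] -/
theorem palasekTowerBreakdown_not_heredityAtOne_or_not_heredityFromTwo_of_noSwirl_design
    (h : ∃ (S : Schedule TowerRates.wide)
      (_ : Stage 1 TowerRates.wide S (Margins.routeG TowerRates.wide) 1),
      S.Pins 8 (6 / 5) ∧ S.Rigid ∧ S.Quiet ∧ S.f = 0 ∧ IsAxisymmetric S.u₀ ∧ HasNoSwirl S.u₀) :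
    (∃ k, 1 ≤ k ∧ RungG k ∧ ¬ HeredityAt k) ∧
      (¬ PalasekTowerBreakdown.HeredityAtOne ∨ ¬ PalasekTowerBreakdown.HeredityFromTwo) := by
  obtain ⟨S, s, hP, hR, hQ, hf, hA, hS⟩ := h
  obtain ⟨k, hk, hRk, hH⟩ := exists_rungG_not_heredityAt_of_noSwirl hP hR hQ s hf hA hS
  refine ⟨⟨k, hk, hRk, hH⟩, ?_⟩
  rcases Nat.lt_or_ge k 2 with hlt | hge
  · have hk1 : k = 1 := by omega
    subst hk1
    exact Or.inl fun h₁ => hH (heredityAtOne_iff.1 h₁)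
  · exact Or.inr fun h₂ => hH (HeredityFrom.heredityAt h₂ hge)

end Summit.NavierStokesRegularity.PalasekTowerBreakdownNegative

end
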